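import Summits.QuantumFields.YangMills.Theorems.BalabanUVNodesN15TwoSpacingGluingCommutator
import Summits.QuantumFields.YangMills.Theorems.BalabanUVNodesN15CovariantLaplacianSpecies
import HarnessLib

/-!
# Route «BalabanUVNodes» (cluster K4 «SpineRates»), Track-A DAG node N15 = NE2, BACKGROUND LAYER — THE `W`-COMMUTATOR ROW OF THE GLUING FOR THE BACKGROUND SPECIES: `[V, M_h]∘G` for
# `V = M_C + Σ_μ(M_{A⁺_μ}∇⁺_μ + M_{A⁻_μ}∇⁻_μ)` (the first-order operator of (3.52)–(3.53), `Δ_U = Δ_1 − V(c_U, a_U)`) EXACTLY through the cube's entries 0∕1, and its (2.134)-shaped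
# letter in dag-n15-c's row currency

Cell `pub-ymgap`, seat `pub-ymgap-dag-n15-w3` (WIDTH SEAT 3∕3 on node N15, director-ym №197 ∕ HUMAN RULING D-0149; plan `W-SEAT-START-LIST.md` §n15 item 3 — twelfth piece, the `W`-row
dag-n15-c g11's FILE 46 displays).  `bears_on: R4∕N15 · K3⁷ SpineGivenEndpointR13SepCoPH (stmt-QuantumFields-20544)`.  Filed `--kind proof --supports stmt-QuantumFields-20544 --as helper` —
COUNT-NEUTRAL.  Imports BY NAME dag-n15-c FILE 46 `…N15TwoSpacingGluingCommutator` (`Gluing.commOp`, `commOp_add_left`, `commOp_fsum_left`, `hasMaj_diag_comp`, `hasMaj_fsum`,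
`hasMaj_mulOp_comp_loc`; through it lit `B6Prop26Gluing.mulOp`∕`ind`, `T4EtaRateCoeffDefect.diagK`, `B11SectG.HasMaj`) and dag-n15-c FILE 28 `…N15CovariantLaplacianSpecies`
(`speciesOpM`, `linearMap_sum_comp`; through it n15-b `fgrad`∕`bgrad`, `mmulOp`, `liftEquiv`, `liftBlk`, `hasMaj_mmulOp`); nothing in the tree is modified.

WHY.  dag-n15-c's gluing at two spacings (FILES 43–46) inverts `Δ_a = Σ_μ∇*_μ∇_μ + W` from cube-localized propagators and displays, per cube, the commutator row
`[W, M_h]∘G ≤ 1_S(y)1_S(y′)·θ_W·e^{−δd}` (`hasMaj_commOp_lapOp_comp`'s `hW`; [Balaban1984PropagatorsII] (2.134) p. 247, obtained p. 239 *«Using the formulas (1.126)–(1.128)»*).  At a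
LIVE background `U` the operator to invert is the covariant Laplacian, and dag-n15-c FILE 28's (3.53) reads it as `Δ_U = Δ_1 − V(c, a)` with the FIRST-ORDER species
`V = speciesOpM τ n C A = M_C + Σ_μ(M_{A⁺_μ}∇⁺_μ + M_{A⁻_μ}∇⁻_μ)` ([Balaban1985BackgroundPropagators] (3.52)–(3.53) p. 400) — so `W ∋ −V`, and THIS FILE supplies its row: since the matrix
coefficients commute with the (ι-constant) partition function, `[V, M_h] = Σ_μ(M_{A⁺}[∇⁺, M_h] + M_{A⁻}[∇⁻, M_h])`, and the lattice Leibniz rules give `[∇⁺, M_h]G = M_{∇⁺h}G +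
M_{h∘e − h}(∇⁺G)`, `[∇⁻, M_h]G = M_{∇⁻h}G − M_{h − h∘e⁻¹}(∇⁻G)` — ONLY the cube's entries 0∕1 appear, with the partition's letters `|∇^±h| ≤ c₁`, `|h∘e^{±1} − h| ≤ c₀` (`= c₁∕n`) and the
species' row letter `r_A`: `θ_V = |J|·2r_A(c₁β + c₀β₁)` — `O(M⁻¹)` through `c₁, c₀`, and `O(α₁)` through `r_A` ((3.37)-shaped `|a| ≤ α₁(L^jη)^{−1}`).

* §1 `commOp_eq_zero_of_comm`, `commOp_comp_eq_of_comm`, ★ `commOp_fgrad_comp`, ★ `commOp_bgrad_comp` (any lattice), `mmulOp_comp_mulOp_fst` (matrix coefficients commute with ι-constant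
  multipliers), ★★ `commOp_speciesOpM_comp` (the exact expansion above);
* §2 ★★ `hasMaj_commOp_speciesOpM_comp` — dag-n15-c FILE 46's `hW` row for `W = V`: `[V, M_h]∘G ≤ 1_S(y)1_S(y′)·(|J|·(2r_A(c₁β + c₀β₁)))·e^{−δd}` from the cube's entries
  `G ≤ 1_S1_S·βe^{−δd}`, `∇^±_μG ≤ 1_S1_S·β₁e^{−δd}`, the partition letters and `Σ_k|A^±_μ(x)_{ik}| ≤ r_A`; `hasMaj_commOp_neg_speciesOpM_comp` (the row for `W = −V` verbatim).

HONEST FRAMING ∕ LIMITS.  Lattice Leibniz bookkeeping in dag-n15-c's row currency (no estimate); the cube's entries and the letters are DISPLAYED; the η-defect row `r_W` of FILE 46's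
`hasMaj_idef_commOp_lapOp_comp` for `W = V` (three-factor Leibniz with the coefficient fit `o_A`, `hasMaj_idef_mmulOp`) is NOT in this file (successor); the `Q*aQ`∕`DRD*` rows are
dag-n15-c∕dag-n15-a's; nothing of [B6]∕[B9] asserted ((3.52)–(3.53) p. 400, (2.134) p. 247 = SHAPES ∕ MECHANISM).  NE2⁺ NOT PRINTED, NOT proved; N15 NOT discharged; counts of record
UNMOVED (typed 28∕28 · discharged 5∕27); one finite 𝕋⁴ at fixed ε — NOT infinite volume, NOT OS on ℝ⁴, NOT a mass gap, NOT Clay; R4 closes the conditional finite-𝕋⁴ rung `BalabanLadder.UV`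
only.  Restate-immune (no Theses import).
-/

set_option autoImplicit false

noncomputable section
open scoped BigOperators
open Finset

namespace Summit.QuantumFields.YangMills.BalabanUVNodes.N15.CurvedSpecies

open Literature.MathematicalPhysics.QuantumFieldTheory.Balaban1983to89
open Literature.MathematicalPhysics.QuantumFieldTheory.Balaban1983to89.B11SectG (BlockNorm HasMaj)
open Literature.MathematicalPhysics.QuantumFieldTheory.Balaban1983to89.T4EtaRateCoeffDefect (diagK diagK_nonneg)
open Literature.MathematicalPhysics.QuantumFieldTheory.Balaban1983to89.B6Prop26Gluing (mulOp mulOp_apply ind ind_nonneg)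
open Summit.QuantumFields.YangMills.BalabanUVNodes.N15.MatrixSpecies (mmulOp mmulOp_apply liftBlk liftEquiv liftEquiv_apply liftEquiv_symm_apply hasMaj_mmulOp)
open Summit.QuantumFields.YangMills.BalabanUVNodes.N15.BackgroundLayer (fgrad bgrad fgrad_apply bgrad_apply speciesOpM linearMap_sum_comp)
open Summit.QuantumFields.YangMills.BalabanUVNodes.N15.Gluing (commOp commOp_add_left commOp_fsum_left hasMaj_diag_comp hasMaj_fsum hasMaj_mulOp_comp_loc)

/-! ## §1 The lattice Leibniz rules for `[∇^±, M_h]` and the exact expansion of `[V, M_h]∘G` -/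

section Leibniz

variable {Y : Type}

/-- An operator commuting with `M_h` has vanishing commutator. [folklore] -/
theorem commOp_eq_zero_of_comm {M : (Y → ℝ) →ₗ[ℝ] (Y → ℝ)} {h : Y → ℝ} (hc : M ∘ₗ mulOp h = mulOp h ∘ₗ M) : commOp M h = 0 := by
  rw [commOp, hc, sub_self]

/-- `[M∘D, M_h] = M∘[D, M_h]` when `M` commutes with `M_h`. [folklore] -/
theorem commOp_comp_eq_of_comm {M D : (Y → ℝ) →ₗ[ℝ] (Y → ℝ)} {h : Y → ℝ} (hc : M ∘ₗ mulOp h = mulOp h ∘ₗ M) : commOp (M ∘ₗ D) h = M ∘ₗ commOp D h := by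
  refine LinearMap.ext fun f => ?_
  have hf := LinearMap.congr_fun hc (D f)
  simp only [commOp, LinearMap.sub_apply, LinearMap.comp_apply, map_sub] at hf ⊢
  rw [hf]

/-- ★ THE LEIBNIZ RULE, FORWARD: `[∇⁺, M_h]∘G = M_{∇⁺h}∘G + M_{h∘e − h}∘(∇⁺∘G)` (`∇⁺f = n(f∘e − f)`) — only the entries `G`, `∇⁺G`. [cite: Balaban1984PropagatorsII, p.239 («the formulas (1.126)–(1.128)»: shape)] -/
theorem commOp_fgrad_comp (n : ℝ) (e : Y ≃ Y) (h : Y → ℝ) (G : (Y → ℝ) →ₗ[ℝ] (Y → ℝ)) :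
    commOp (fgrad n e) h ∘ₗ G = mulOp (fgrad n e h) ∘ₗ G + mulOp (fun y => h (e y) - h y) ∘ₗ (fgrad n e ∘ₗ G) := by
  refine LinearMap.ext fun f => funext fun y => ?_
  simp only [commOp, LinearMap.sub_apply, LinearMap.comp_apply, LinearMap.add_apply, Pi.add_apply, Pi.sub_apply, mulOp_apply, fgrad_apply]
  ring

/-- ★ THE LEIBNIZ RULE, BACKWARD: `[∇⁻, M_h]∘G = M_{∇⁻h}∘G − M_{h − h∘e⁻¹}∘(∇⁻∘G)` (`∇⁻f = n(f − f∘e⁻¹)`). [cite: Balaban1984PropagatorsII, p.239 (shape)] -/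
theorem commOp_bgrad_comp (n : ℝ) (e : Y ≃ Y) (h : Y → ℝ) (G : (Y → ℝ) →ₗ[ℝ] (Y → ℝ)) :
    commOp (bgrad n e) h ∘ₗ G = mulOp (bgrad n e h) ∘ₗ G - mulOp (fun y => h y - h (e.symm y)) ∘ₗ (bgrad n e ∘ₗ G) := by
  refine LinearMap.ext fun f => funext fun y => ?_
  simp only [commOp, LinearMap.sub_apply, LinearMap.comp_apply, Pi.sub_apply, mulOp_apply, bgrad_apply]
  ring

variable {X ι J : Type} [Fintype ι] [Fintype J]

omit [Fintype J] in
/-- MATRIX COEFFICIENTS COMMUTE WITH ι-CONSTANT MULTIPLIERS: `M_C∘M_h = M_h∘M_C` for `h = h_X ∘ pr₁` (the partition function does not see the colour index). [folklore] -/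
theorem mmulOp_comp_mulOp_fst (C : X → Matrix ι ι ℝ) (hX : X → ℝ) :
    mmulOp C ∘ₗ mulOp (fun p : X × ι => hX p.1) = mulOp (fun p : X × ι => hX p.1) ∘ₗ mmulOp C := by
  refine LinearMap.ext fun f => funext fun p => ?_
  simp only [LinearMap.comp_apply, mmulOp_apply, mulOp_apply, Finset.mul_sum]
  exact Finset.sum_congr rfl fun j _ => by ring

variable (τ : J → X ≃ X) (n : ℝ) (C : X → Matrix ι ι ℝ) (A : J ⊕ J → X → Matrix ι ι ℝ) (hX : X → ℝ) (G : (X × ι → ℝ) →ₗ[ℝ] (X × ι → ℝ))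

/-- ★★ **THE COMMUTATOR OF THE BACKGROUND SPECIES WITH A PARTITION FUNCTION, EXACTLY**: for `V = M_C + Σ_μ(M_{A⁺_μ}∇⁺_μ + M_{A⁻_μ}∇⁻_μ)` (`speciesOpM`) and ι-constant `h`,
`[V, M_h]∘G = Σ_μ [M_{A⁺_μ}∘(M_{∇⁺_μh}∘G + M_{h∘e_μ − h}∘(∇⁺_μ∘G)) + M_{A⁻_μ}∘(M_{∇⁻_μh}∘G − M_{h − h∘e_μ⁻¹}∘(∇⁻_μ∘G))]` — the zeroth-order part drops out (`[M_C, M_h] = 0`), only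
the cube's entries `G`, `∇^±G` appear. [cite: Balaban1985BackgroundPropagators, (3.52)–(3.53) p.400 (V: shape); Balaban1984PropagatorsII, (2.134) p.247, p.239 (mechanism)] -/
theorem commOp_speciesOpM_comp :
    commOp (speciesOpM τ n C A) (fun p : X × ι => hX p.1) ∘ₗ G =
      ∑ μ, (mmulOp (A (Sum.inl μ)) ∘ₗ (mulOp (fgrad n (liftEquiv (τ μ) ι) (fun p : X × ι => hX p.1)) ∘ₗ G +
          mulOp (fun p : X × ι => hX ((liftEquiv (τ μ) ι) p).1 - hX p.1) ∘ₗ (fgrad n (liftEquiv (τ μ) ι) ∘ₗ G)) +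
        mmulOp (A (Sum.inr μ)) ∘ₗ (mulOp (bgrad n (liftEquiv (τ μ) ι) (fun p : X × ι => hX p.1)) ∘ₗ G -
          mulOp (fun p : X × ι => hX p.1 - hX ((liftEquiv (τ μ) ι).symm p).1) ∘ₗ (bgrad n (liftEquiv (τ μ) ι) ∘ₗ G))) := by
  have hC : commOp (mmulOp C) (fun p : X × ι => hX p.1) = 0 := commOp_eq_zero_of_comm (mmulOp_comp_mulOp_fst C hX)
  have hμ : ∀ μ, commOp (mmulOp (A (Sum.inl μ)) ∘ₗ fgrad n (liftEquiv (τ μ) ι) + mmulOp (A (Sum.inr μ)) ∘ₗ bgrad n (liftEquiv (τ μ) ι)) (fun p : X × ι => hX p.1) ∘ₗ G =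
      mmulOp (A (Sum.inl μ)) ∘ₗ (mulOp (fgrad n (liftEquiv (τ μ) ι) (fun p : X × ι => hX p.1)) ∘ₗ G +
          mulOp (fun p : X × ι => hX ((liftEquiv (τ μ) ι) p).1 - hX p.1) ∘ₗ (fgrad n (liftEquiv (τ μ) ι) ∘ₗ G)) +
        mmulOp (A (Sum.inr μ)) ∘ₗ (mulOp (bgrad n (liftEquiv (τ μ) ι) (fun p : X × ι => hX p.1)) ∘ₗ G -
          mulOp (fun p : X × ι => hX p.1 - hX ((liftEquiv (τ μ) ι).symm p).1) ∘ₗ (bgrad n (liftEquiv (τ μ) ι) ∘ₗ G)) := fun μ => by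
    rw [commOp_add_left, LinearMap.add_comp, commOp_comp_eq_of_comm (mmulOp_comp_mulOp_fst _ hX), commOp_comp_eq_of_comm (mmulOp_comp_mulOp_fst _ hX),
      LinearMap.comp_assoc, LinearMap.comp_assoc, commOp_fgrad_comp, commOp_bgrad_comp]
  unfold speciesOpM
  rw [commOp_add_left, hC, zero_add, commOp_fsum_left, linearMap_sum_comp]
  exact Finset.sum_congr rfl fun μ _ => hμ μ

end Leibniz

/-! ## §2 The (2.134)-shaped row of the species commutator from the cube's entries 0∕1 -/

section Row

variable {X ι J : Type} [Fintype X] [Fintype ι] [Fintype J] {g : B6.Geometry} (blk : X → g.Site)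
variable (τ : J → X ≃ X) (n : ℝ) (C : X → Matrix ι ι ℝ) (A : J ⊕ J → X → Matrix ι ι ℝ) (hX : X → ℝ) (G : (X × ι → ℝ) →ₗ[ℝ] (X × ι → ℝ))

/-- ★★ **dag-n15-c FILE 46's `hW` ROW FOR `W = V`, THE BACKGROUND SPECIES.**  Data: the cube's entries in the gluing currency — `G ≤ 1_S(y)1_S(y′)·βe^{−δd}`, `∇⁺_μG, ∇⁻_μG ≤
1_S1_S·β₁e^{−δd}` on the vector carrier `X × ι` (blocks `liftBlk blk ι`); the partition function `h = h_X∘pr₁` with `|∇^±_μh| ≤ c₁` and `|h∘e_μ^{±1} − h| ≤ c₀`; the species' coefficient rows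
`Σ_k |A^±_μ(x)_{ik}| ≤ r_A`.  Then `[V, M_h]∘G ≤ 1_S(y)1_S(y′)·(|J|·(2·r_A·(c₁β + c₀β₁)))·e^{−δd}`. [cite: Balaban1984PropagatorsII, (2.134) p.247 (shape); Balaban1985BackgroundPropagators, (3.37) p.396, (3.52) p.400 (shapes)] -/
theorem hasMaj_commOp_speciesOpM_comp {S : Set g.Site} {β β₁ c₁ c₀ rA δ : ℝ} (hc₁ : 0 ≤ c₁) (hc₀ : 0 ≤ c₀) (hrA : 0 ≤ rA)
    (hh1 : ∀ μ p, |fgrad n (liftEquiv (τ μ) ι) (fun p : X × ι => hX p.1) p| ≤ c₁) (hh1b : ∀ μ p, |bgrad n (liftEquiv (τ μ) ι) (fun p : X × ι => hX p.1) p| ≤ c₁)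
    (hh0 : ∀ μ (p : X × ι), |hX ((liftEquiv (τ μ) ι) p).1 - hX p.1| ≤ c₀) (hh0b : ∀ μ (p : X × ι), |hX p.1 - hX ((liftEquiv (τ μ) ι).symm p).1| ≤ c₀)
    (hA : ∀ j x i, ∑ k, |A j x i k| ≤ rA)
    (hG : HasMaj (BlockNorm.ofBlocks g (liftBlk blk ι)) (BlockNorm.ofBlocks g (liftBlk blk ι)) G (fun y y' => ind S y * ind S y' * (β * Real.exp (-(δ * g.dist y y')))))
    (hD : ∀ μ, HasMaj (BlockNorm.ofBlocks g (liftBlk blk ι)) (BlockNorm.ofBlocks g (liftBlk blk ι)) (fgrad n (liftEquiv (τ μ) ι) ∘ₗ G)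
      (fun y y' => ind S y * ind S y' * (β₁ * Real.exp (-(δ * g.dist y y')))))
    (hDb : ∀ μ, HasMaj (BlockNorm.ofBlocks g (liftBlk blk ι)) (BlockNorm.ofBlocks g (liftBlk blk ι)) (bgrad n (liftEquiv (τ μ) ι) ∘ₗ G)
      (fun y y' => ind S y * ind S y' * (β₁ * Real.exp (-(δ * g.dist y y'))))) :
    HasMaj (BlockNorm.ofBlocks g (liftBlk blk ι)) (BlockNorm.ofBlocks g (liftBlk blk ι)) (commOp (speciesOpM τ n C A) (fun p : X × ι => hX p.1) ∘ₗ G)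
      (fun y y' => ind S y * ind S y' * ((Fintype.card J * (2 * rA * (c₁ * β + c₀ * β₁))) * Real.exp (-(δ * g.dist y y')))) := by
  have hMA : ∀ j, HasMaj (BlockNorm.ofBlocks g (liftBlk blk ι)) (BlockNorm.ofBlocks g (liftBlk blk ι)) (mmulOp (A j)) (diagK fun _ => rA) :=
    fun j => hasMaj_mmulOp blk (m := fun _ => rA) (fun _ => hrA) (fun x i => hA j x i)
  -- each direction: the forward and the backward term, both `≤ r_A·(c₁β + c₀β₁)`
  have hterm : ∀ μ, HasMaj (BlockNorm.ofBlocks g (liftBlk blk ι)) (BlockNorm.ofBlocks g (liftBlk blk ι))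
      (mmulOp (A (Sum.inl μ)) ∘ₗ (mulOp (fgrad n (liftEquiv (τ μ) ι) (fun p : X × ι => hX p.1)) ∘ₗ G +
          mulOp (fun p : X × ι => hX ((liftEquiv (τ μ) ι) p).1 - hX p.1) ∘ₗ (fgrad n (liftEquiv (τ μ) ι) ∘ₗ G)) +
        mmulOp (A (Sum.inr μ)) ∘ₗ (mulOp (bgrad n (liftEquiv (τ μ) ι) (fun p : X × ι => hX p.1)) ∘ₗ G -
          mulOp (fun p : X × ι => hX p.1 - hX ((liftEquiv (τ μ) ι).symm p).1) ∘ₗ (bgrad n (liftEquiv (τ μ) ι) ∘ₗ G)))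
      (fun y y' => ind S y * ind S y' * ((2 * rA * (c₁ * β + c₀ * β₁)) * Real.exp (-(δ * g.dist y y')))) := fun μ => by
    have f1 := hasMaj_mulOp_comp_loc (liftBlk blk ι) hc₁ (hh1 μ) hG
    have f2 := hasMaj_mulOp_comp_loc (liftBlk blk ι) hc₀ (hh0 μ) (hD μ)
    have b1 := hasMaj_mulOp_comp_loc (liftBlk blk ι) hc₁ (hh1b μ) hG
    have b2 := hasMaj_mulOp_comp_loc (liftBlk blk ι) hc₀ (hh0b μ) (hDb μ)
    have tf := hasMaj_diag_comp (liftBlk blk ι) (fun _ => hrA) (hMA (Sum.inl μ)) (f1.add f2)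
    have tb := hasMaj_diag_comp (liftBlk blk ι) (fun _ => hrA) (hMA (Sum.inr μ)) (b1.sub b2)
    refine (tf.add tb).mono fun y y' => le_of_eq ?_
    ring
  rw [commOp_speciesOpM_comp]
  refine (hasMaj_fsum (b₁ := BlockNorm.ofBlocks g (liftBlk blk ι)) (b₃ := BlockNorm.ofBlocks g (liftBlk blk ι)) Finset.univ _ _ fun μ _ => hterm μ).mono fun y y' => le_of_eq ?_
  simp only [Finset.sum_const, Finset.card_univ, nsmul_eq_mul]
  ring

/-- THE ROW FOR `W = −V` (the sign of (3.53): `Δ_U = Δ_1 − V`): `[−V, M_h]∘G` has the same letter. [cite: Balaban1985BackgroundPropagators, (3.53) p.400 (shape)] -/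
theorem hasMaj_commOp_neg_speciesOpM_comp {S : Set g.Site} {β β₁ c₁ c₀ rA δ : ℝ} (hc₁ : 0 ≤ c₁) (hc₀ : 0 ≤ c₀) (hrA : 0 ≤ rA)
    (hh1 : ∀ μ p, |fgrad n (liftEquiv (τ μ) ι) (fun p : X × ι => hX p.1) p| ≤ c₁) (hh1b : ∀ μ p, |bgrad n (liftEquiv (τ μ) ι) (fun p : X × ι => hX p.1) p| ≤ c₁)
    (hh0 : ∀ μ (p : X × ι), |hX ((liftEquiv (τ μ) ι) p).1 - hX p.1| ≤ c₀) (hh0b : ∀ μ (p : X × ι), |hX p.1 - hX ((liftEquiv (τ μ) ι).symm p).1| ≤ c₀)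
    (hA : ∀ j x i, ∑ k, |A j x i k| ≤ rA)
    (hG : HasMaj (BlockNorm.ofBlocks g (liftBlk blk ι)) (BlockNorm.ofBlocks g (liftBlk blk ι)) G (fun y y' => ind S y * ind S y' * (β * Real.exp (-(δ * g.dist y y')))))
    (hD : ∀ μ, HasMaj (BlockNorm.ofBlocks g (liftBlk blk ι)) (BlockNorm.ofBlocks g (liftBlk blk ι)) (fgrad n (liftEquiv (τ μ) ι) ∘ₗ G)
      (fun y y' => ind S y * ind S y' * (β₁ * Real.exp (-(δ * g.dist y y')))))
    (hDb : ∀ μ, HasMaj (BlockNorm.ofBlocks g (liftBlk blk ι)) (BlockNorm.ofBlocks g (liftBlk blk ι)) (bgrad n (liftEquiv (τ μ) ι) ∘ₗ G)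
      (fun y y' => ind S y * ind S y' * (β₁ * Real.exp (-(δ * g.dist y y'))))) :
    HasMaj (BlockNorm.ofBlocks g (liftBlk blk ι)) (BlockNorm.ofBlocks g (liftBlk blk ι)) (commOp (-speciesOpM τ n C A) (fun p : X × ι => hX p.1) ∘ₗ G)
      (fun y y' => ind S y * ind S y' * ((Fintype.card J * (2 * rA * (c₁ * β + c₀ * β₁))) * Real.exp (-(δ * g.dist y y')))) := by
  have hneg : commOp (-speciesOpM τ n C A) (fun p : X × ι => hX p.1) ∘ₗ G = -(commOp (speciesOpM τ n C A) (fun p : X × ι => hX p.1) ∘ₗ G) := by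
    simp only [commOp, LinearMap.neg_comp, LinearMap.comp_neg, neg_sub_neg, LinearMap.sub_comp]
    abel
  rw [hneg]
  exact (hasMaj_commOp_speciesOpM_comp blk τ n C A hX G hc₁ hc₀ hrA hh1 hh1b hh0 hh0b hA hG hD hDb).neg

end Row

end Summit.QuantumFields.YangMills.BalabanUVNodes.N15.CurvedSpecies

end
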